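import Literature.Barriers.Parity.SiegelZeroDichotomyPairHLProp71Core
import HarnessLib

/-!
# Tao–Teräväinen 2022, Proposition 7.1: the reductions

Topic `Literature/Barriers/Parity`, sub-namespace `TaoTeravainen`; a file of the proof DAG of
`Literature.Barriers.Parity.TaoTeravainen2021_prop72_81_pair` (T. Tao, J. Teräväinen, *The
Hardy–Littlewood–Chowla conjecture in the presence of a Siegel zero*, J. London Math. Soc. (2) 106
(2022), arXiv:2109.06291), proof of Proposition 7.1 (i), the reductions preceding Lemma 3.9:
"By the fundamental theorem of calculus … by the triangle inequality it will suffice to show that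
`∑_{n ∈ I, n ≡ a (q)} f((n-a)/q) χ∗Φ̃_t(n) ≪ …` for all `Dq_χ² ≤ t ≤ x/(Dq_χ²)²` … We can
approximate `1_I` by a cutoff `ψ_I` … we can absorb the `f` factor by enlarging `q` to `q q_χ` and
worsening the bound by a factor of `q_χ` … it suffices to establish (7.5)." Everything is PROVED:

* `abs_sum_mul_flatLog_le` — **the `t`-integral**: if `|∑_N w(N) K̃_v(N)| ≤ Bd` for all
  `v ∈ [U₀, X-U₀]`, then `|∑_N w(N) (χ∗log)♭(N)| ≤ (1 + sup|ψ|) X³ Bd`;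
* `card_filter_class_Ico_le` — a residue class mod `Q₁` meets a real interval `[lo, hi)` in at
  most `(hi-lo)/Q₁ + 1` integers (for the small-`n` truncation and the smoothing error);
* `sum_hypKD_mul_eq_sum_hypCongrSum` — **hyperbola form and sub-progressions**:
  `∑_{N ≤ M} 1_{N ≡ a (Q₁)} f((N-a)/Q₁) ψ_I(N) K̃_v(N) = ∑_{j < q} f(j) T(a + Q₁ j mod Q₁q)`,
  with `T` = `hypCongrSum` (weight `G = Φ̃_t(n₂)ψ_I(n₁n₂)`), for `f` `q`-periodic, `B ≤ M`;
* `gcd_val_subProgression_dvd` — `(a + Q₁j mod Q₁q, Q₁q) ∣ (a, Q₁) q`.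
  [cite: TaoTeravainen2021, proof of Proposition 7.1 (reductions to (7.5))]
-/

noncomputable section

open Finset Real MeasureTheory intervalIntegral
open scoped ContDiff Topology

namespace Literature.Barriers.Parity

namespace TaoTeravainen

open Literature.Analysis.Calculus

variable {q : ℕ}

/-! ### The `t`-integral (in `v = log t`) -/

/-- **The `t`-integral reduction**: for `0 < U₀`, `2U₀ ≤ X`, weights `w`, and a bound `Bd` for the
`K̃_v`-sums on `v ∈ [U₀, X - U₀]`,
`|∑_N w(N) (χ∗log)♭(N)| ≤ (1 + sup|ψ|) X³ Bd` ("by the triangle inequality it will suffice to show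
… for all `Dq_χ² ≤ t ≤ x/(Dq_χ²)²`"). [cite: TaoTeravainen2021, proof of Proposition 7.1] -/
theorem abs_sum_mul_flatLog_le {φ ψ : ℝ → ℝ} (hφ : IsBump φ) (hψ : IsSmoothCutoff ψ) {Bψ : ℝ}
    (hBψ : ∀ u, |ψ u| ≤ Bψ) (χ : DirichletCharacter ℂ q) {X U₀ : ℝ} (hU₀ : 0 < U₀) (hX : 2 * U₀ ≤ X)
    (S : Finset ℕ) (w : ℕ → ℝ) {Bd : ℝ}
    (hBd : ∀ v ∈ Set.Icc U₀ (X - U₀), |∑ N ∈ S, w N * hypKD χ φ v N| ≤ Bd) :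
    |∑ N ∈ S, w N * flatLog χ φ ψ X U₀ N| ≤ (1 + Bψ) * X ^ 3 * Bd := by
  have hBψ0 : 0 ≤ 1 + Bψ := by linarith [(abs_nonneg _).trans (hBψ 0)]
  have hX0 : 0 ≤ X := by linarith
  have hBd0 : 0 ≤ Bd := (abs_nonneg _).trans (hBd U₀ ⟨le_rfl, by linarith⟩)
  have hXU : U₀ ≤ X - U₀ := by linarith
  -- each term as an integral
  have hterm : ∀ N ∈ S, w N * flatLog χ φ ψ X U₀ N =
      ∫ v in U₀..(X - U₀), -(w N * (flatKernel ψ X U₀ v * hypKD χ φ v N)) := by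
    intro N _
    rw [flatLog_eq_neg_integral hφ hψ χ hU₀ hX N, intervalIntegral.integral_neg,
      intervalIntegral.integral_const_mul]
    ring
  -- continuity of the integrands on `[U₀, X - U₀]`
  have hcontP : ContinuousOn (flatKernel ψ X U₀) (Set.Icc U₀ (X - U₀)) := by
    intro v hv
    exact (hasDerivAt_flatKernel hψ X U₀ (by linarith [hv.2] : v < X)).continuousAt.continuousWithinAt
  have hint : ∀ N ∈ S, IntervalIntegrable (fun v => -(w N * (flatKernel ψ X U₀ v * hypKD χ φ v N)))
      volume U₀ (X - U₀) := by
    intro N _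
    refine (ContinuousOn.intervalIntegrable ?_)
    rw [Set.uIcc_of_le hXU]
    exact ((continuousOn_const.mul (hcontP.mul (continuous_hypKD hφ χ N).continuousOn))).neg
  rw [sum_congr rfl hterm, ← intervalIntegral.integral_finsetSum hint]
  -- pointwise bound of the integrand
  have hbound : ∀ v ∈ Set.uIoc U₀ (X - U₀),
      ‖∑ N ∈ S, -(w N * (flatKernel ψ X U₀ v * hypKD χ φ v N))‖ ≤ (1 + Bψ) * X ^ 2 * Bd := by
    intro v hv
    rw [Set.uIoc_of_le hXU] at hv
    have hv' : v ∈ Set.Icc U₀ (X - U₀) := ⟨hv.1.le, hv.2⟩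
    have hsum : ∑ N ∈ S, -(w N * (flatKernel ψ X U₀ v * hypKD χ φ v N)) =
        -(flatKernel ψ X U₀ v * ∑ N ∈ S, w N * hypKD χ φ v N) := by
      rw [mul_sum, ← sum_neg_distrib]
      refine sum_congr rfl fun N _ => ?_; ring
    rw [hsum, norm_neg, Real.norm_eq_abs, abs_mul]
    have hP := abs_flatKernel_le hBψ (X := X) (U₀ := U₀) (v := v) (by linarith [hv.1]) (by linarith [hv.2])
    calc |flatKernel ψ X U₀ v| * |∑ N ∈ S, w N * hypKD χ φ v N|
        ≤ ((1 + Bψ) * X * (X - v)) * Bd := mul_le_mul hP (hBd v hv') (abs_nonneg _) (by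
            have : 0 ≤ X - v := by linarith [hv.2]
            positivity)
      _ ≤ ((1 + Bψ) * X * X) * Bd := by
          have : X - v ≤ X := by linarith [hv.1]
          gcongr
      _ = (1 + Bψ) * X ^ 2 * Bd := by ring
  have h := intervalIntegral.norm_integral_le_of_norm_le_const hbound
  rw [Real.norm_eq_abs] at h
  refine h.trans ?_
  rw [abs_of_nonneg (by linarith)]
  have : X - U₀ - U₀ ≤ X := by linarith
  calc (1 + Bψ) * X ^ 2 * Bd * (X - U₀ - U₀) ≤ (1 + Bψ) * X ^ 2 * Bd * X := by gcongr
    _ = (1 + Bψ) * X ^ 3 * Bd := by ring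

/-! ### Counting a residue class in an interval -/

/-- `⌊a⌋ < ⌊b⌋` when `0 ≤ a` and `a + 1 ≤ b`. [folklore] -/
theorem floor_lt_floor_of_add_one_le {a b : ℝ} (h0 : 0 ≤ a) (h1 : a + 1 ≤ b) : ⌊a⌋₊ < ⌊b⌋₊ := by
  have h2 : ⌊a + 1⌋₊ ≤ ⌊b⌋₊ := Nat.floor_le_floor h1
  rw [Nat.floor_add_one h0] at h2
  omega

/-- A residue class modulo `Q₁ ≥ 1` meets `{N : lo ≤ N < hi}` in at most `(hi - lo)/Q₁ + 1`
natural numbers (`lo ≤ hi`). [folklore] -/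
theorem card_filter_class_Ico_le {Q₁ : ℕ} (hQ₁ : 0 < Q₁) (a : ℤ) {lo hi : ℝ} (hlohi : lo ≤ hi)
    (S : Finset ℕ) :
    (((S.filter (fun N : ℕ => (N : ℤ) ≡ a [ZMOD Q₁] ∧ lo ≤ (N : ℝ) ∧ (N : ℝ) < hi)).card : ℕ) : ℝ) ≤
      (hi - lo) / Q₁ + 1 := by
  set T := S.filter (fun N : ℕ => (N : ℤ) ≡ a [ZMOD Q₁] ∧ lo ≤ (N : ℝ) ∧ (N : ℝ) < hi) with hT
  have hQr : (0 : ℝ) < Q₁ := by exact_mod_cast hQ₁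
  set K : ℕ := ⌊(hi - lo) / Q₁⌋₊ with hK
  -- the map `N ↦ ⌊(N - lo)/Q₁⌋` is injective on the class and lands in `range (K+1)`
  have hmaps : Set.MapsTo (fun N : ℕ => ⌊((N : ℝ) - lo) / Q₁⌋₊) (T : Set ℕ) ((range (K + 1)) : Set ℕ) := by
    intro N hN
    rw [hT, coe_filter, Set.mem_setOf_eq] at hN
    rw [coe_range, Set.mem_Iio, Nat.lt_succ_iff, hK]
    exact Nat.floor_le_floor (div_le_div_of_nonneg_right (by linarith [hN.2.2.2]) hQr.le)
  have hinj : Set.InjOn (fun N : ℕ => ⌊((N : ℝ) - lo) / Q₁⌋₊) (T : Set ℕ) := by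
    intro N hN N' hN' h
    rw [hT, coe_filter, Set.mem_setOf_eq] at hN hN'
    by_contra hne
    -- two distinct elements of the class differ by at least `Q₁`
    have hmod : (N : ℤ) ≡ N' [ZMOD Q₁] := hN.2.1.trans hN'.2.1.symm
    have hdvd : (Q₁ : ℤ) ∣ (N' : ℤ) - N := Int.ModEq.dvd hmod
    rcases lt_or_gt_of_ne hne with hlt | hlt
    · -- `N < N'`, so `N' ≥ N + Q₁` and the floors differ
      have hle : (N : ℤ) + Q₁ ≤ N' := by
        obtain ⟨k, hk⟩ := hdvd
        have hk0 : 0 < k := by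
          by_contra h0; push Not at h0
          have : (N' : ℤ) - N ≤ 0 := by rw [hk]; exact mul_nonpos_of_nonneg_of_nonpos (by positivity) h0
          omega
        nlinarith
      have hle' : (N : ℝ) + Q₁ ≤ N' := by exact_mod_cast hle
      have h1 : ((N : ℝ) - lo) / Q₁ + 1 ≤ ((N' : ℝ) - lo) / Q₁ := by
        rw [div_add_one hQr.ne', div_le_div_iff_of_pos_right hQr]; linarith
      have h0 : 0 ≤ ((N : ℝ) - lo) / Q₁ := div_nonneg (by linarith [hN.2.2.1]) hQr.le
      exact absurd h (ne_of_lt (floor_lt_floor_of_add_one_le h0 h1))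
    · have hle : (N' : ℤ) + Q₁ ≤ N := by
        obtain ⟨k, hk⟩ := hdvd
        have hk0 : k < 0 := by
          by_contra h0; push Not at h0
          have : 0 ≤ (N' : ℤ) - N := by rw [hk]; positivity
          omega
        nlinarith
      have hle' : (N' : ℝ) + Q₁ ≤ N := by exact_mod_cast hle
      have h1 : ((N' : ℝ) - lo) / Q₁ + 1 ≤ ((N : ℝ) - lo) / Q₁ := by
        rw [div_add_one hQr.ne', div_le_div_iff_of_pos_right hQr]; linarith
      have h0 : 0 ≤ ((N' : ℝ) - lo) / Q₁ := div_nonneg (by linarith [hN'.2.2.1]) hQr.le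
      exact absurd h.symm (ne_of_lt (floor_lt_floor_of_add_one_le h0 h1))
  have hcard := card_le_card_of_injOn _ hmaps hinj
  rw [card_range] at hcard
  calc ((T.card : ℕ) : ℝ) ≤ ((K + 1 : ℕ) : ℝ) := by exact_mod_cast hcard
    _ = (K : ℝ) + 1 := by push_cast; ring
    _ ≤ (hi - lo) / Q₁ + 1 := by
        rw [hK]
        gcongr
        exact Nat.floor_le (div_nonneg (by linarith) hQr.le)

/-! ### The hyperbola form -/

/-- Reindexing `∑_{N ≤ M} ∑_{n₁n₂ = N} F(n₁,n₂) = ∑_{n₁,n₂ ≤ M} F(n₁,n₂)` when `F` vanishes for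
`n₁n₂ > M`. [folklore] -/
theorem sum_Icc_sum_antidiagonal_eq {F : ℕ → ℕ → ℝ} (M : ℕ)
    (hF : ∀ n₁ n₂ : ℕ, M < n₁ * n₂ → F n₁ n₂ = 0) :
    ∑ N ∈ Icc 1 M, ∑ p ∈ N.divisorsAntidiagonal, F p.1 p.2 =
      ∑ n₁ ∈ Icc 1 M, ∑ n₂ ∈ Icc 1 M, F n₁ n₂ := by
  rw [← sum_product']
  -- drop the pairs with `n₁ n₂ > M`
  rw [← sum_filter_of_ne (s := Icc 1 M ×ˢ Icc 1 M) (p := fun p : ℕ × ℕ => p.1 * p.2 ≤ M)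
    (fun p _ hp => by by_contra h; exact hp (hF p.1 p.2 (not_le.mp h)))]
  have hmaps : ∀ p ∈ (Icc 1 M ×ˢ Icc 1 M).filter (fun p : ℕ × ℕ => p.1 * p.2 ≤ M),
      p.1 * p.2 ∈ Icc 1 M := by
    intro p hp
    rw [mem_filter, mem_product, mem_Icc, mem_Icc] at hp
    rw [mem_Icc]
    exact ⟨Nat.one_le_iff_ne_zero.mpr (Nat.mul_ne_zero (by omega) (by omega)), hp.2⟩
  rw [← sum_fiberwise_of_maps_to hmaps]
  refine sum_congr rfl fun N hN => ?_
  rw [mem_Icc] at hN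
  apply sum_congr
  · ext ⟨x, y⟩
    simp only [mem_filter, mem_product, mem_Icc, Nat.mem_divisorsAntidiagonal, ne_eq]
    constructor
    · rintro ⟨h, -⟩
      have hx : x ≠ 0 := fun h0 => by rw [h0, zero_mul] at h; omega
      have hy : y ≠ 0 := fun h0 => by rw [h0, mul_zero] at h; omega
      refine ⟨⟨⟨⟨Nat.one_le_iff_ne_zero.mpr hx, ?_⟩, ⟨Nat.one_le_iff_ne_zero.mpr hy, ?_⟩⟩, by omega⟩, h⟩
      · calc x ≤ x * y := Nat.le_mul_of_pos_right x (Nat.pos_of_ne_zero hy)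
          _ ≤ M := by omega
      · calc y ≤ x * y := Nat.le_mul_of_pos_left y (Nat.pos_of_ne_zero hx)
          _ ≤ M := by omega
    · rintro ⟨⟨-, -⟩, h⟩; exact ⟨h, by omega⟩
  · intro p _; rfl

/-- **The hyperbola form**: for weights `w` and `B ≤ M`,
`∑_{N ≤ M} w(N) ψ_I(N) K̃_v(N) = ∑_{n₁,n₂ ≤ M} w(n₁n₂) χ(n₁) G(n₁,n₂)` with
`G(n₁,n₂) = Φ̃_t(n₂) ψ_I(n₁n₂)`. [cite: TaoTeravainen2021, proof of Proposition 7.1 (the sum (7.5))] -/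
theorem sum_mul_hypKD_eq_sum_hypWeight (χ : DirichletCharacter ℂ q) (φ : ℝ → ℝ) {A B Δ : ℝ}
    (hΔ : 0 < Δ) (v : ℝ) {M : ℕ} (hBM : B ≤ M) (w : ℕ → ℝ) :
    ∑ N ∈ Icc 1 M, w N * plateauProfile A B Δ N * hypKD χ φ v N =
      ∑ n₁ ∈ Icc 1 M, ∑ n₂ ∈ Icc 1 M, w (n₁ * n₂) * realChar χ n₁ * hypWeight φ A B Δ v n₁ n₂ := by
  have hlhs : ∀ N ∈ Icc 1 M, w N * plateauProfile A B Δ N * hypKD χ φ v N =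
      ∑ p ∈ N.divisorsAntidiagonal,
        w (p.1 * p.2) * realChar χ p.1 * hypWeight φ A B Δ v p.1 p.2 := by
    intro N _
    unfold hypKD
    rw [mul_sum]
    refine sum_congr rfl fun p hp => ?_
    rw [Nat.mem_divisorsAntidiagonal] at hp
    have hp2 : p.2 ≠ 0 := fun h => hp.2 (by rw [← hp.1, h, mul_zero])
    unfold hypWeight hypDerivWeight
    rw [if_neg hp2, hp.1]
    ring
  rw [sum_congr rfl hlhs]
  refine sum_Icc_sum_antidiagonal_eq
    (F := fun n₁ n₂ => w (n₁ * n₂) * realChar χ n₁ * hypWeight φ A B Δ v n₁ n₂) M fun n₁ n₂ hlt => ?_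
  unfold hypWeight
  have : B ≤ ((n₁ * n₂ : ℕ) : ℝ) := hBM.trans (by exact_mod_cast hlt.le)
  rw [plateauProfile_eq_zero_of_ge hΔ this, mul_zero, mul_zero]

/-! ### Sub-progressions -/

/-- A `q`-periodic `f : ℤ → ℝ` satisfies `f(k + q m) = f(k)` for all integers `m`. [folklore] -/
theorem periodic_int_mul {f : ℤ → ℝ} {q : ℕ} (hf : ∀ k : ℤ, f (k + q) = f k) (k m : ℤ) :
    f (k + q * m) = f k := by
  induction m using Int.induction_on with
  | zero => rw [mul_zero, add_zero]
  | succ m ih => rw [mul_add, mul_one, ← add_assoc, hf, ih]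
  | pred m ih =>
    have := hf (k + q * (-(m : ℤ) - 1))
    rw [show k + (q : ℤ) * (-(m : ℤ) - 1) + q = k + q * (-(m : ℤ)) by ring] at this
    rw [← this]
    exact ih

/-- **Sub-progressions**: for `f` `q`-periodic, `Q₁, q ≥ 1`,
`1_{N ≡ a (Q₁)} f((N-a)/Q₁) = ∑_{j < q} f(j) 1_{N ≡ a + Q₁ j (Q₁ q)}` ("we can absorb the `f`
factor by enlarging `q` to `q q_χ`"). [cite: TaoTeravainen2021, proof of Proposition 7.1] -/
theorem indicator_mul_periodic_eq_sum {f : ℤ → ℝ} {q : ℕ} (hq : 0 < q) (hf : ∀ k : ℤ, f (k + q) = f k)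
    {Q₁ : ℕ} (hQ₁ : 0 < Q₁) (a N : ℤ) :
    (if N ≡ a [ZMOD Q₁] then f ((N - a) / Q₁) else 0) =
      ∑ j ∈ range q, f j * (if N ≡ a + Q₁ * j [ZMOD ((Q₁ * q : ℕ) : ℤ)] then 1 else 0) := by
  have hQ₁z : (Q₁ : ℤ) ≠ 0 := by exact_mod_cast hQ₁.ne'
  have hqz : (0 : ℤ) < q := by exact_mod_cast hq
  by_cases hN : N ≡ a [ZMOD Q₁]
  · rw [if_pos hN]
    obtain ⟨k, hk⟩ : (Q₁ : ℤ) ∣ N - a := (Int.ModEq.dvd hN.symm)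
    have hk' : (N - a) / Q₁ = k := by rw [hk, Int.mul_ediv_cancel_left _ hQ₁z]
    rw [hk']
    -- the congruence `N ≡ a + Q₁ j (Q₁ q)` is `k ≡ j (q)`
    have hiff : ∀ j : ℕ, (N ≡ a + Q₁ * j [ZMOD ((Q₁ * q : ℕ) : ℤ)]) ↔ (k ≡ j [ZMOD q]) := by
      intro j
      have hN' : N = a + Q₁ * k := by linarith
      rw [hN', Nat.cast_mul]
      constructor
      · intro h
        have h2 : (Q₁ : ℤ) * k ≡ Q₁ * j [ZMOD Q₁ * q] := by
          have := Int.ModEq.add_left_cancel' a h; exact this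
        exact (Int.ModEq.mul_left_cancel_iff' hQ₁z).mp h2
      · intro h
        exact Int.ModEq.add_left a ((Int.ModEq.mul_left_cancel_iff' hQ₁z).mpr h)
    simp_rw [hiff]
    -- exactly one `j < q` is `≡ k (mod q)`, namely `j₀ = k mod q`
    set j₀ : ℕ := (k % q).toNat with hj₀
    have hk0 : 0 ≤ k % q := Int.emod_nonneg _ hqz.ne'
    have hj₀k : (j₀ : ℤ) = k % q := by rw [hj₀, Int.toNat_of_nonneg hk0]
    have hj₀lt : j₀ < q := by
      have : (j₀ : ℤ) < q := by rw [hj₀k]; exact Int.emod_lt_of_pos _ hqz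
      exact_mod_cast this
    simp_rw [mul_ite, mul_one, mul_zero]
    rw [← sum_filter, Finset.sum_eq_single_of_mem j₀]
    · -- `f j₀ = f k`
      rw [hj₀k]
      have := periodic_int_mul hf (k % q) (k / q)
      rw [Int.emod_add_mul_ediv] at this
      exact this
    · rw [mem_filter, mem_range]
      refine ⟨hj₀lt, ?_⟩
      rw [Int.ModEq, hj₀k, Int.emod_emod_of_dvd _ dvd_rfl]
    · intro j hj hne
      rw [mem_filter, mem_range] at hj
      exfalso
      apply hne
      -- `j ≡ k ≡ j₀ (mod q)` with both in `[0, q)`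
      have h1 : (j : ℤ) % q = j₀ % q := by
        rw [hj₀k, Int.emod_emod_of_dvd _ dvd_rfl]; exact hj.2.symm
      have h2 : ((j % q : ℕ) : ℤ) = ((j₀ % q : ℕ) : ℤ) := by push_cast; exact h1
      have h3 : j % q = j₀ % q := by exact_mod_cast h2
      rwa [Nat.mod_eq_of_lt hj.1, Nat.mod_eq_of_lt hj₀lt] at h3
  · rw [if_neg hN]
    symm
    refine sum_eq_zero fun j _ => ?_
    rw [if_neg, mul_zero]
    intro h
    apply hN
    have h1 : N ≡ a + Q₁ * j [ZMOD Q₁] :=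
      h.of_dvd (by rw [Nat.cast_mul]; exact Dvd.intro _ rfl)
    have h2 : a + Q₁ * j ≡ a [ZMOD Q₁] := by
      have : a + Q₁ * j ≡ a + 0 [ZMOD Q₁] :=
        Int.ModEq.add_left a (Int.modEq_zero_iff_dvd.mpr (Dvd.intro _ rfl))
      rwa [add_zero] at this
    exact h1.trans h2


/-- The sub-progression residue `a + Q₁ j mod Q₁q`. [cite: TaoTeravainen2021, proof of Proposition 7.1] -/
def subProgression (Q₁ q : ℕ) (a : ℤ) (j : ℕ) : ZMod (Q₁ * q) := ((a + Q₁ * j : ℤ) : ZMod (Q₁ * q))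

/-- **Hyperbola form and sub-progressions combined**: for `f` `q`-periodic, `Q₁, q ≥ 1`, `Δ > 0`,
`B ≤ M`: `∑_{N ≤ M} 1_{N ≡ a (Q₁)} f((N-a)/Q₁) ψ_I(N) K̃_v(N) = ∑_{j < q} f(j) T(a + Q₁ j mod Q₁q)`
(`T` = `hypCongrSum`). [cite: TaoTeravainen2021, proof of Proposition 7.1 (reduction to (7.5))] -/
theorem sum_hypKD_mul_eq_sum_hypCongrSum (χ : DirichletCharacter ℂ q) (φ : ℝ → ℝ) {A B Δ : ℝ}
    (hΔ : 0 < Δ) (v : ℝ) {M : ℕ} (hBM : B ≤ M) {f : ℤ → ℝ} {q' : ℕ} (hq' : 0 < q')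
    (hf : ∀ k : ℤ, f (k + q') = f k) {Q₁ : ℕ} (hQ₁ : 0 < Q₁) (a : ℤ) :
    ∑ N ∈ Icc 1 M, (if (N : ℤ) ≡ a [ZMOD Q₁] then f (((N : ℤ) - a) / Q₁) else 0) *
        plateauProfile A B Δ N * hypKD χ φ v N =
      ∑ j ∈ range q', f j * hypCongrSum χ φ A B Δ v M (Q₁ * q') (subProgression Q₁ q' a j) := by
  haveI : NeZero (Q₁ * q') := ⟨Nat.mul_ne_zero hQ₁.ne' hq'.ne'⟩
  -- expand the indicator into sub-progressions
  have h1 : ∀ N : ℕ, (if (N : ℤ) ≡ a [ZMOD Q₁] then f (((N : ℤ) - a) / Q₁) else 0) =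
      ∑ j ∈ range q', f j * (if ((N : ℕ) : ZMod (Q₁ * q')) = subProgression Q₁ q' a j then 1 else 0) := by
    intro N
    rw [indicator_mul_periodic_eq_sum hq' hf hQ₁ a N]
    refine sum_congr rfl fun j _ => ?_
    congr 1
    have hiff : ((N : ℤ) ≡ a + Q₁ * j [ZMOD ((Q₁ * q' : ℕ) : ℤ)]) ↔
        (((N : ℕ) : ZMod (Q₁ * q')) = subProgression Q₁ q' a j) := by
      unfold subProgression
      rw [show ((N : ℕ) : ZMod (Q₁ * q')) = (((N : ℤ)) : ZMod (Q₁ * q')) from (Int.cast_natCast N).symm,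
        ZMod.intCast_eq_intCast_iff]
    simp only [hiff]
  simp_rw [h1, sum_mul]
  rw [sum_comm]
  refine sum_congr rfl fun j _ => ?_
  have h2 : ∀ N ∈ Icc 1 M, f j * (if ((N : ℕ) : ZMod (Q₁ * q')) = subProgression Q₁ q' a j then 1 else 0) *
      plateauProfile A B Δ N * hypKD χ φ v N =
      f j * ((if ((N : ℕ) : ZMod (Q₁ * q')) = subProgression Q₁ q' a j then 1 else 0) *
        plateauProfile A B Δ N * hypKD χ φ v N) := fun N _ => by ring
  rw [sum_congr rfl h2, ← mul_sum, sum_mul_hypKD_eq_sum_hypWeight χ φ hΔ v hBM]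
  unfold hypCongrSum
  congr 1
  refine sum_congr rfl fun n₁ _ => sum_congr rfl fun n₂ _ => ?_
  ring

/-- `|∑_{j<q} f(j) T_j| ≤ q · Tmax` for `|f| ≤ 1`, `|T_j| ≤ Tmax`. [folklore] -/
theorem abs_sum_mul_le_card_mul {f : ℤ → ℝ} (hf1 : ∀ k, |f k| ≤ 1) {q' : ℕ} {T : ℕ → ℝ} {Tmax : ℝ}
    (hT : ∀ j ∈ range q', |T j| ≤ Tmax) : |∑ j ∈ range q', f j * T j| ≤ q' * Tmax := by
  calc |∑ j ∈ range q', f j * T j| ≤ ∑ j ∈ range q', |f j * T j| := abs_sum_le_sum_abs _ _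
    _ ≤ ∑ j ∈ range q', Tmax := sum_le_sum fun j hj => by
        rw [abs_mul]
        calc |f j| * |T j| ≤ 1 * Tmax := mul_le_mul (hf1 _) (hT j hj) (abs_nonneg _) zero_le_one
          _ = Tmax := one_mul _
    _ = q' * Tmax := by rw [sum_const, card_range, nsmul_eq_mul]

/-- **The gcd of a sub-progression residue**: `(a + Q₁j mod Q₁q, Q₁q) ∣ (a, Q₁)·q`.
[cite: TaoTeravainen2021, proof of Proposition 7.1 ("replacing `a` by a residue class `a' mod qq_χ`
… note that `(a', qq_χ) ≤ q_χ (a,q)`")] -/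
theorem gcd_val_subProgression_dvd {Q₁ q' : ℕ} (hQ₁ : 0 < Q₁) (hq' : 0 < q') (a : ℤ) (j : ℕ) :
    Nat.gcd (subProgression Q₁ q' a j).val (Q₁ * q') ∣ Int.gcd a Q₁ * q' := by
  haveI : NeZero (Q₁ * q') := ⟨Nat.mul_ne_zero hQ₁.ne' hq'.ne'⟩
  set w := subProgression Q₁ q' a j with hw
  set d := Nat.gcd w.val (Q₁ * q') with hd
  -- `d ∣ gcd d Q₁ * gcd d q'`
  have h1 : d ∣ Nat.gcd d Q₁ * Nat.gcd d q' :=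
    Nat.dvd_gcd_mul_gcd_iff_dvd_mul.mpr (Nat.gcd_dvd_right _ _)
  refine h1.trans (Nat.mul_dvd_mul ?_ (Nat.gcd_dvd_right _ _))
  -- `gcd d Q₁ ∣ (a, Q₁)`: it divides `Q₁` and `w.val ≡ a (mod Q₁)` as integers
  set d₁ := Nat.gcd d Q₁ with hd₁
  have hd₁Q : d₁ ∣ Q₁ := Nat.gcd_dvd_right _ _
  have hd₁w : d₁ ∣ w.val := (Nat.gcd_dvd_left _ _).trans (Nat.gcd_dvd_left _ _)
  -- the congruence
  have hcong : ((w.val : ℕ) : ℤ) ≡ a + Q₁ * j [ZMOD ((Q₁ * q' : ℕ) : ℤ)] := by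
    rw [← ZMod.intCast_eq_intCast_iff, Int.cast_natCast, ZMod.natCast_zmod_val]
    rfl
  have hcong' : ((w.val : ℕ) : ℤ) ≡ a [ZMOD (Q₁ : ℤ)] := by
    have h2 : ((w.val : ℕ) : ℤ) ≡ a + Q₁ * j [ZMOD (Q₁ : ℤ)] :=
      hcong.of_dvd (by rw [Nat.cast_mul]; exact Dvd.intro _ rfl)
    have h3 : a + Q₁ * j ≡ a + 0 [ZMOD (Q₁ : ℤ)] :=
      Int.ModEq.add_left a (Int.modEq_zero_iff_dvd.mpr (Dvd.intro _ rfl))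
    rw [add_zero] at h3
    exact h2.trans h3
  have hda : (d₁ : ℤ) ∣ a := by
    have h4 : (d₁ : ℤ) ∣ (w.val : ℤ) := by exact_mod_cast hd₁w
    have h5 : (d₁ : ℤ) ∣ (w.val : ℤ) - a := (Int.natCast_dvd_natCast.mpr hd₁Q).trans (Int.ModEq.dvd hcong'.symm)
    have := Int.dvd_sub h4 h5
    rwa [sub_sub_cancel] at this
  have : (d₁ : ℤ) ∣ (Int.gcd a Q₁ : ℤ) := by
    rw [Int.gcd]
    exact Int.natCast_dvd_natCast.mpr (Nat.dvd_gcd (Int.natCast_dvd.mp hda) (by simpa using hd₁Q))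
  exact_mod_cast this


end TaoTeravainen

end Literature.Barriers.Parity
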